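import Summits.BirchSwinnertonDyer.BirchSwinnertonDyer.Theorems.KolyvaginRankRigidityAtTwoSwapAuxClassGlobalAtTwo
import Summits.BirchSwinnertonDyer.BirchSwinnertonDyer.Theorems.KolyvaginRankRigidityAtTwoSwapWeilDatumLiftChange
import Summits.BirchSwinnertonDyer.BirchSwinnertonDyer.Theorems.KolyvaginRankRigidityAtTwoTransverseLagrangianAtTwo
import Summits.BirchSwinnertonDyer.BirchSwinnertonDyer.Theorems.Rank1ResidualJetTransverseConj
import HarnessLib

/-!
# Crux V2♭θ `KolyvaginCorankLowerBoundAtTwoTheta` (stmt-BirchSwinnertonDyer-27220), line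
# `kolyvagin_depth_split`, inside of S1, piece **P5** for the RING-CLASS TRANSVERSE FAMILY — the transverse
# hypotheses discharged (helper, PROVED; seat `bsd-line-krr2-p2` g7)

`exists_auxClass_large_of_localTransverseFamily_two`: this seat's `exists_auxClass_large_at_two` (`hP5` of the
lead's S1 composition, `c₅ = 5`, `M ≥ 9`) for the ring-class transverse family of the composition (shape `h𝒯` of
the lead's `dualTransported_eq_of_localTransverseFamily_two`), with its two transverse inputs DISCHARGED: (iso)
`h𝒯sd` by the lead's Lagrangian theorem at `2` (margin one) and (stab) `h𝒯σ` by the `τ`-stability of the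
ring-class transverse conditions (`JET.GlobalDuality.conjActPlace_mem_transverseSubgroup_ringClassField`, any
level; the tree's packaged `conjActPlace_mem_transverseFamily_forall` carries an idle `p ≠ 2` binder, so the
unfolding is redone here); and the Weil datum's equivariance taken in the frame's `liftAut τ` form
(`weil_equivariant_of_isLiftOfAut`).  Remaining inputs: Zhang's numerics at `a` and on `c`, the Poitou–Tate
package (`IsPerfect`, `SumLocalTermEqZero`, `SelmerComplement`, `IsConjCompatible τ`), the Weil datum.
HONEST FRAMING: helper (`--supports` 27220); S1 / V2♭θ are NOT proved; BSD is not proved by any of this.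

References: [cite: Kolyvagin1991MathAnn, §2 (proof of Thm. 2.2)] [cite: McCallumLMS1991, §5 Prop. 5.2]
[cite: Jetchev2008, §3.2 (1)–(2), §5 Thm. 5.1] [cite: GrossLMS1991, §3].
-/

set_option autoImplicit false
set_option linter.dupNamespace false

noncomputable section

open scoped Classical
open Function NumberField IsDedekindDomain WeierstrassCurve Field
open Literature.NumberTheory.EllipticCurves Literature.NumberTheory.EllipticCurves.Jetchev2008
open Literature.NumberTheory.GaloisRepresentations Literature.NumberTheory.GaloisCohomology
open Literature.NumberTheory.GaloisRepresentations.DiscreteGaloisModule (localTatePairingZMod tateDual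
  transverseSubgroup SelmerStructure)
open Literature.NumberTheory.Automorphic
open Summit.BirchSwinnertonDyer.Rank1Residual
open Summit.BirchSwinnertonDyer.Rank1Residual.JET.SelmerVocabulary
open Summit.BirchSwinnertonDyer.Rank1Residual.JET.GlobalDuality

namespace Summit.BirchSwinnertonDyer.BirchSwinnertonDyer.Theorems.KolyvaginLowerBoundAtTwo

variable (W : WeierstrassCurve ℚ) [W.IsElliptic] [W.IsGloballyMinimal] (K : Type) [Field K] [NumberField K]

/-- **P5 for the ring-class transverse family at `2`** (`c₅ = 5`, `M ≥ 9`), transverse inputs discharged: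
see the file docstring. [cite: Kolyvagin1991MathAnn, §2 (proof of Thm. 2.2)] [cite: McCallumLMS1991, §5 Prop. 5.2]
[cite: Jetchev2008, §5 Thm. 5.1] -/
theorem exists_auxClass_large_of_localTransverseFamily_two (hK : IsImaginaryQuadratic K)
    (hD : NumberField.discr K < -4) (ι : K →+* ℂ) [∀ j : ℕ, NumberField (ringClassField K ι j)]
    (τ : K ≃ₐ[ℚ] K) (hτ1 : τ ≠ 1) (hττ : τ * τ = 1)
    (M : ℕ) (hM : 9 ≤ M) [NeZero (2 ^ M)] [Finite (geomTorsion (W.baseChange K) ((2 ^ M : ℕ) : ℤ))]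
    (c : ℕ) (hc : Squarefree c)
    (hkol : ∀ ℓ ∈ c.primeFactors, Zhang2014.IsKolyvaginPrime (W.conductorNorm ℤ) W K 2 ℓ)
    (hkM : ∀ ℓ ∈ c.primeFactors, M + 1 ≤ Zhang2014.kolyvaginIndex W 2 ℓ)
    (𝒯 : SelmerStructure ((W.baseChange K).torsionGaloisModule ((2 ^ M : ℕ) : ℤ)))
    (h𝒯 : ∀ v : HeightOneSpectrum (𝓞 K), 𝒯 (Sum.inr v) =
      ⨅ ℓ ∈ c.primeFactors.filter (fun ℓ : ℕ ↦ ((ℓ : ℕ) : 𝓞 K) ∈ v.asIdeal),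
        ⨅ (w' : HeightOneSpectrum (𝓞 (ringClassField K ι ℓ))) (_ : w'.asIdeal.LiesOver v.asIdeal),
          letI := (adicCompletionOfLiesOver K (ringClassField K ι ℓ) v w').toAlgebra
          transverseSubgroup (GaloisRep.toLocal v ((W.baseChange K).torsionGaloisModule ((2 ^ M : ℕ) : ℤ)))
            (w'.adicCompletion (ringClassField K ι ℓ)))
    (e : geomTorsion (W.baseChange K) ((2 ^ M : ℕ) : ℤ) → geomTorsion (W.baseChange K) ((2 ^ M : ℕ) : ℤ) →
      AlgebraicClosure K)
    (hμ : ∀ S T, e S T ^ (2 ^ M) = 1)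
    (hadd₁ : ∀ S₁ S₂ T, e (S₁ + S₂) T = e S₁ T * e S₂ T)
    (hadd₂ : ∀ S T₁ T₂, e S (T₁ + T₂) = e S T₁ * e S T₂)
    (hgal : ∀ (g : absoluteGaloisGroup K) (S T : geomTorsion (W.baseChange K) ((2 ^ M : ℕ) : ℤ)),
      g • e S T = e (g • S) (g • T))
    (halt : ∀ T, e T T = 1) (hnondeg : ∀ T, (∀ S, e S T = 1) → T = 0)
    (hτe : ∀ S T, liftAut τ (e S T) =
      e ((isLiftOfAut_liftAut τ).torsionMap W ((2 ^ M : ℕ) : ℤ) S)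
        ((isLiftOfAut_liftAut τ).torsionMap W ((2 ^ M : ℕ) : ℤ) T))
    (inv : LocalInvariants K (2 ^ M)) (hperf : inv.IsPerfect) (hvan : inv.SumLocalTermEqZero)
    (hSC : inv.SelmerComplement) (hinvc : inv.IsConjCompatible τ)
    {a : ℕ} (ha : Zhang2014.IsKolyvaginPrime (W.conductorNorm ℤ) W K 2 a)
    (hMa : M + 1 ≤ Zhang2014.kolyvaginIndex W 2 a) (hac : ¬ a ∣ c)
    (v₀ : HeightOneSpectrum (𝓞 K)) (hv₀ : ((a : ℕ) : 𝓞 K) ∈ v₀.asIdeal)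
    {s : ℤ} (hs : s = 1 ∨ s = -1) :
    ∃ w : galoisCohomology ((W.baseChange K).torsionGaloisModule ((2 ^ M : ℕ) : ℤ)) 1,
      w ∈ signPart W K τ ((2 ^ M : ℕ) : ℤ) s
        (((selmerF W ((2 ^ M : ℕ) : ℤ) 𝒯 (placesDividing K c)).relaxedAt {v₀}).selmerGroup) ∧
      ((2 ^ (M / 2 - 5) : ℕ) : ℤ) • w ≠ 0 := by
  classical
  have hc0 : c ≠ 0 := hc.ne_zero
  have hM1 : 1 ≤ M := by omega
  have ha0 : a ≠ 0 := ha.1.ne_zero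
  have hfix : τ • v₀ = v₀ := smul_place_eq_self_of_natCast_mem τ ha0 ha.2.2.2.2.1 v₀ hv₀
  -- the Weil datum is equivariant under the adapted lift at `v₀`
  have hτe' : ∀ S T, liftAutPlace τ hfix (e S T) =
      e ((isLiftOfAut_liftAutPlace τ hfix).torsionMap W ((2 ^ M : ℕ) : ℤ) S)
        ((isLiftOfAut_liftAutPlace τ hfix).torsionMap W ((2 ^ M : ℕ) : ℤ) T) :=
    weil_equivariant_of_isLiftOfAut W ((2 ^ M : ℕ) : ℤ) (isLiftOfAut_liftAutPlace τ hfix) (isLiftOfAut_liftAut τ)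
      e hgal hτe
  -- (iso) at the places of `c`
  have h𝒯sd : ∀ v ∈ placesDividing K c,
      inv.dualTransported 𝒯 (weilDualIntertwining (W.baseChange K) (2 ^ M) e hμ hadd₁ hadd₂ hgal) (Sum.inr v) =
        𝒯 (Sum.inr v) := fun v hv =>
    dualTransported_eq_of_localTransverseFamily_two W K hK hD ι M hM1 c hc hkol hkM 𝒯 h𝒯 e hμ hadd₁ hadd₂ hgal
      halt hnondeg inv hperf v hv
  -- (stab) `τ`-stability of the family at the places of `c`
  have h𝒯σ : ∀ (v w : HeightOneSpectrum (𝓞 K)) (h : τ • v = w), v ∈ placesDividing K c →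
      ∀ x : galoisCohomology (((W.baseChange K).torsionGaloisModule ((2 ^ M : ℕ) : ℤ)).toLocal
        (Sum.inr v : Place K)) 1, x ∈ 𝒯 (Sum.inr v) → conjActPlace W τ ((2 ^ M : ℕ) : ℤ) h x ∈ 𝒯 (Sum.inr w) := by
    intro v w h _ x hx
    have hmem : ∀ ℓ : ℕ, ((ℓ : ℕ) : 𝓞 K) ∈ w.asIdeal ↔ ((ℓ : ℕ) : 𝓞 K) ∈ v.asIdeal := by
      intro ℓ
      rw [← h]
      have hτℓ : τ • ((ℓ : ℕ) : 𝓞 K) = ((ℓ : ℕ) : 𝓞 K) := by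
        rw [← MulSemiringAction.toRingHom_apply, map_natCast]
      have h2 := HeightOneSpectrum.smul_mem_smul_asIdeal_iff τ v ((ℓ : ℕ) : 𝓞 K)
      rw [hτℓ] at h2
      exact h2
    rw [h𝒯 w]
    refine AddSubgroup.mem_iInf.mpr fun ℓ => AddSubgroup.mem_iInf.mpr fun hℓf =>
      AddSubgroup.mem_iInf.mpr fun w'' => AddSubgroup.mem_iInf.mpr fun hw'' => ?_
    obtain ⟨hℓ, hℓw⟩ := Finset.mem_filter.mp hℓf
    have hℓ0 : ℓ ≠ 0 := (Nat.prime_of_mem_primeFactors hℓ).ne_zero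
    obtain ⟨w₁⟩ := (SemiLocal.Place.nonempty : Nonempty (SemiLocal.Place K (ringClassField K ι ℓ) v))
    haveI hw' := SemiLocal.Place.liesOver w₁
    -- `x` is transverse at `(ℓ, w₁)`
    have hle : 𝒯 (Sum.inr v) ≤ (letI := (adicCompletionOfLiesOver K (ringClassField K ι ℓ) v
        (w₁ : HeightOneSpectrum (𝓞 (ringClassField K ι ℓ)))).toAlgebra
        transverseSubgroup (GaloisRep.toLocal v ((W.baseChange K).torsionGaloisModule ((2 ^ M : ℕ) : ℤ)))
          ((w₁ : HeightOneSpectrum (𝓞 (ringClassField K ι ℓ))).adicCompletion (ringClassField K ι ℓ))) := by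
      rw [h𝒯 v]
      exact (iInf₂_le ℓ (Finset.mem_filter.mpr ⟨hℓ, (hmem ℓ).mp hℓw⟩)).trans
        (iInf₂_le (w₁ : HeightOneSpectrum (𝓞 (ringClassField K ι ℓ))) hw')
    haveI := hw''
    exact JET.conjActPlace_mem_transverseSubgroup_ringClassField W hK ι τ ((2 ^ M : ℕ) : ℤ) hℓ0 h
      (w₁ : HeightOneSpectrum (𝓞 (ringClassField K ι ℓ))) w'' (hle hx)
  exact exists_auxClass_large_at_two W τ M e hμ hadd₁ hadd₂ hgal halt hnondeg inv 𝒯 hK hτ1 hττ hperf hvan hSC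
    hinvc hM hc0 h𝒯sd h𝒯σ ha hMa hac v₀ hv₀ hfix hτe' hs

end Summit.BirchSwinnertonDyer.BirchSwinnertonDyer.Theorems.KolyvaginLowerBoundAtTwo

end
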